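import Mathlib
import Summits.CriticalPhenomena.PercolationContinuityZ3.Theorems.PercNearOneGluingNoHeavyQuantBlockCombStrong
import Summits.CriticalPhenomena.PercolationContinuityZ3.Theorems.PercNearOneGluingNoHeavyQuantFarTreeRowContraction
import Summits.CriticalPhenomena.PercolationContinuityZ3.Theorems.PercNearOneGluingNoHeavyQuantFarRelayRowStar
import Literature.Probability.LatticeModels.ProdBernoulliBlocks
import HarnessLib

/-!
# QUANT lane R8, FAR on trees: block-combs in the strong regime — GATE COORDINATES (product Bernoulli gates; the canonical model
# of `…QuantBlockCombStrong` identified with the relay count of an explicit block-comb)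

builds on p205010 (kernel theorem, internal audit signed; external expert review pending)

Support file (`--supports stmt-CriticalPhenomena-4575`), QUANT lane seat prim-quant-p1 (gen 8); memo
`run/shared/lean/prim/quant/P1-SURPLUS.md` §19.  Theorems only, no sorries, standard axioms.

**Setting (explicit block-comb data on a product space).**  Independent gates `q : E → [0,1]` on a finite coordinate type `E`
(`prodBernoulli q` on `Set E`); a CHAIN `ch : Fin D → E` (injective; gate `ch i` at depth `i`); BLOBS `k : κ` with pairwise disjoint
private gate sets `G k ⊆ E` off the chain and a level `lv k ≤ D`.  Blob `k` is REACHED in `ω` when the chain prefix `ch 0, …, ch (lv k − 1)`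
and all of `G k` lie in `ω`; it then contributes its `(G k).card` relays (the relays of a glued class are its private gates; a class of
`a` relays behind one gate `g` is one gate of probability `g` and `a − 1` sure ones).  This is the block-comb of LEAD-NOTES-G10 N21 (0)
(root-level blobs `lv = 0`, the terminal block a blob at level `D`), i.e. `Quant.FarTreeRow`'s setting with ancestor finsets
`P y = ch''{i < lv k} ∪ G k` for `y ∈ G k`.

* `Quant.BlockCombGate.real_blobCount_eq_sum` — reading the blobs (block principle `prodBernoulli_real_preimage_readBlocks`): the
  probability that the blobs `k` with `lv k ≤ i` and `G k ⊆ ω` carry `≥ j+1` relays is the finite sum `Σ_S wt S·𝟙[…]` of the canonical model.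
* `Quant.BlockCombGate.tail_succ` — the canonical tail one chain gate longer: `TAIL[D+1, qc] = (1 − qc 0)·X₀ + qc 0 · TAIL[D, qc ∘ succ]`.
* `Quant.BlockCombGate.real_heavy_eq_tail` — **identification**: `P(#reached relays ≥ j+1) = TAIL[D, q ∘ ch, lv, card ∘ G, ∏_{G k} q, j]`
  (induction on `D`: condition on the top chain gate with `Quant.prodBernoulli_real_gate_split`).
* `Quant.BlockCombGate.farTree_blockComb_strong` — **FAR AT EVERY LAYER FOR BLOCK-COMBS IN THE STRONG REGIME, gate coordinates**:
  if `2j < (Σ_k |G k|)·∏_{G k} q` for every nonempty blob then `P(#reached ≤ j) ≤ t` whenever `1 − (marginal of k) ≤ t` for every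
  nonempty blob (`Quant.BlockComb.tail_ge_of_le_marg_strong`).  Contains every ALL-TIED block-comb (all relay marginals equal, `EN > 2j`).
Route vocabulary (bond weights on `Sym2 (Fin n)`, `Quant.tree_relayCount_transfer`): typer follow-up as `…QuantFarRelayRowBlockCombCell`.
-/

noncomputable section

namespace Summit.CriticalPhenomena.PercolationContinuityZ3.Theorems

namespace Quant

namespace BlockCombGate

open Finset MeasureTheory
open Literature.Probability.LatticeModels
open Literature.Probability.Percolation
open scoped Classical

variable {E : Type*} [Fintype E] [DecidableEq E] {κ : Type*} [Fintype κ] [DecidableEq κ]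

/-- product weight of a set of open blobs (canonical model of `…QuantBlockCombMergeModel`) -/
local notation3 "wt[" g ", " S "]" => ∏ k, (if k ∈ (S : Finset κ) then (g : κ → ℝ) k else 1 - (g : κ → ℝ) k)
/-- depth law of the chain -/
local notation3 "pd[" D ", " q ", " i "]" =>
  (∏ i' ∈ Finset.range (i : ℕ), (q : ℕ → ℝ) i') * (if (i : ℕ) < (D : ℕ) then 1 - (q : ℕ → ℝ) i else 1)
/-- mass counted at depth `i` -/
local notation3 "mass[" lv ", " a ", " i ", " S "]" =>
  ∑ k ∈ (S : Finset κ).filter (fun k => (lv : κ → ℕ) k ≤ (i : ℕ)), ((a : κ → ℕ) k : ℕ)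
/-- the canonical tail -/
local notation3 "TAIL[" D ", " q ", " lv ", " a ", " g ", " j "]" =>
  ∑ i ∈ Finset.range ((D : ℕ) + 1), pd[D, q, i] *
    ∑ S : Finset κ, wt[g, S] * (if (j : ℕ) + 1 ≤ mass[lv, a, i, S] then (1 : ℝ) else 0)

/-! ### 1. Reading the blobs -/

/-- **Block reading.**  For pairwise disjoint gate sets `G k`, the probability under `prodBernoulli q` that the blobs `k` with `lv k ≤ i`
and `G k ⊆ ω` carry at least `j+1` relays is the canonical finite sum with blob gates `∏_{e ∈ G k} q e`. [this work] -/
theorem real_blobCount_eq_sum (q : E → unitInterval) (G : κ → Finset E)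
    (hGdisj : ∀ k k', k ≠ k' → Disjoint (G k) (G k')) (lv : κ → ℕ) (a : κ → ℕ) (i j : ℕ) :
    (prodBernoulli q).real {ω : Set E | j + 1 ≤ ∑ k ∈ Finset.univ.filter (fun k => lv k ≤ i ∧ ((G k : Finset E) : Set E) ⊆ ω), a k} =
      ∑ S : Finset κ, wt[(fun k => ∏ e ∈ G k, (q e : ℝ)), S] *
        (if j + 1 ≤ mass[lv, a, i, S] then (1 : ℝ) else 0) := by
  rcases isEmpty_or_nonempty κ with hκ | hκ
  · -- no blobs: both sides are `𝟙[j+1 ≤ 0] = 0`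
    have hL : {ω : Set E | j + 1 ≤ ∑ k ∈ Finset.univ.filter (fun k => lv k ≤ i ∧ ((G k : Finset E) : Set E) ⊆ ω), a k} = ∅ := by
      ext ω
      simp only [Finset.univ_eq_empty, Finset.filter_empty, Finset.sum_empty, Set.mem_setOf_eq,
        Set.mem_empty_iff_false, iff_false, not_le]
      exact Nat.succ_pos j
    rw [hL, measureReal_empty]
    symm
    refine Finset.sum_eq_zero fun S _ => ?_
    have : ¬ (j + 1 ≤ mass[lv, a, i, S]) := by
      have hS : S = ∅ := Finset.eq_empty_of_isEmpty S
      subst hS; simp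
    rw [if_neg this, mul_zero]
  obtain ⟨k₀⟩ := hκ
  -- blocks: the blob of a private gate, `k₀` for every other coordinate
  set blk : E → κ := fun e => if h : ∃ k, e ∈ G k then Classical.choose h else k₀ with hblk
  have hblkG : ∀ k, ∀ e ∈ G k, blk e = k := by
    intro k e he
    have h : ∃ k, e ∈ G k := ⟨k, he⟩
    have hc := Classical.choose_spec h
    simp only [hblk, dif_pos h]
    by_contra hne
    exact Finset.disjoint_left.1 (hGdisj _ _ hne) hc he
  set g : κ → Set E → Prop := fun k ω => ((G k : Finset E) : Set E) ⊆ ω with hg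
  have hloc : IsBlockLocal blk g := by
    intro k ω ω' hagree
    simp only [hg, Set.subset_def, Finset.mem_coe]
    exact forall_congr' fun e => imp_congr_right fun he => hagree e (hblkG k e he)
  have hmeas : ∀ k, Measurable (g k) := fun k => Measurable.of_discrete
  set q' : κ → unitInterval := fun k => ⟨(prodBernoulli q).real {ω | g k ω}, measureReal_nonneg, measureReal_le_one⟩ with hq'
  have hq'val : ∀ k, ((q' k : unitInterval) : ℝ) = ∏ e ∈ G k, (q e : ℝ) := by
    intro k
    show (prodBernoulli q).real {ω | g k ω} = _
    simp only [hg]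
    rw [prodBernoulli_real_subset]
  have hq : ∀ k, (prodBernoulli q).real {ω | g k ω} = q' k := fun k => rfl
  set T : Set (Set κ) := {W : Set κ | j + 1 ≤ ∑ k ∈ Finset.univ.filter (fun k => lv k ≤ i ∧ k ∈ W), a k} with hT
  have hpre : {ω : Set E | j + 1 ≤ ∑ k ∈ Finset.univ.filter (fun k => lv k ≤ i ∧ ((G k : Finset E) : Set E) ⊆ ω), a k} =
      (fun ω => {k | g k ω}) ⁻¹' T := by
    ext ω
    simp only [hT, hg, Set.mem_setOf_eq, Set.mem_preimage]
  rw [hpre, prodBernoulli_real_preimage_readBlocks q blk hloc hmeas q' hq MeasurableSet.of_discrete,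
    IndepBlob.prodBernoulli_real_eq_sum_finset, Finset.sum_filter]
  refine Finset.sum_congr rfl fun S _ => ?_
  have hmem : ((S : Finset κ) : Set κ) ∈ T ↔ j + 1 ≤ mass[lv, a, i, S] := by
    simp only [hT, Set.mem_setOf_eq, Finset.mem_coe]
    have hf : Finset.univ.filter (fun k => lv k ≤ i ∧ k ∈ S) = S.filter (fun k => lv k ≤ i) := by
      ext k; simp [and_comm]
    rw [hf]
  have hwt : (∏ k, (if k ∈ S then ((q' k : unitInterval) : ℝ) else 1 - ((q' k : unitInterval) : ℝ))) =
      wt[(fun k => ∏ e ∈ G k, (q e : ℝ)), S] := by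
    refine Finset.prod_congr rfl fun k _ => ?_
    rw [hq'val]
  by_cases h : ((S : Finset κ) : Set κ) ∈ T
  · rw [if_pos h, if_pos (hmem.1 h), hwt, mul_one]
  · rw [if_neg h, if_neg (fun h' => h (hmem.2 h')), mul_zero]

/-! ### 2. The canonical tail, one chain gate longer -/

/-- `TAIL[D+1, q] = (1 − q 0)·(mass at depth 0) + q 0 · TAIL[D, q ∘ succ]` (levels shifted down). [this work] -/
theorem tail_succ (D : ℕ) (qc : ℕ → ℝ) (lv : κ → ℕ) (a : κ → ℕ) (g : κ → ℝ) (j : ℕ) :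
    TAIL[D + 1, qc, lv, a, g, j] =
      (1 - qc 0) * (∑ S : Finset κ, wt[g, S] * (if j + 1 ≤ mass[lv, a, 0, S] then (1 : ℝ) else 0)) +
        qc 0 * TAIL[D, (fun i => qc (i + 1)), (fun k => lv k - 1), a, g, j] := by
  rw [Finset.sum_range_succ', add_comm]
  congr 1
  · -- the depth-0 term
    have : pd[D + 1, qc, 0] = 1 - qc 0 := by
      show (∏ i' ∈ Finset.range 0, qc i') * (if 0 < D + 1 then 1 - qc 0 else 1) = 1 - qc 0
      rw [Finset.prod_range_zero, one_mul, if_pos (Nat.succ_pos D)]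
    rw [this]
  · rw [Finset.mul_sum]
    refine Finset.sum_congr rfl fun i hi => ?_
    have hpd : pd[D + 1, qc, i + 1] = qc 0 * pd[D, (fun i => qc (i + 1)), i] := by
      show (∏ i' ∈ Finset.range (i + 1), qc i') * (if i + 1 < D + 1 then 1 - qc (i + 1) else 1) =
        qc 0 * ((∏ i' ∈ Finset.range i, qc (i' + 1)) * (if i < D then 1 - qc (i + 1) else 1))
      rw [Finset.prod_range_succ']
      by_cases hi' : i < D
      · rw [if_pos hi', if_pos (by omega)]; ring
      · rw [if_neg hi', if_neg (by omega)]; ring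
    have hmass : ∀ S : Finset κ, mass[lv, a, i + 1, S] = mass[(fun k => lv k - 1), a, i, S] := by
      intro S
      refine Finset.sum_congr ?_ fun _ _ => rfl
      ext k
      simp only [Finset.mem_filter]
      constructor
      · rintro ⟨hk, hle⟩; exact ⟨hk, by omega⟩
      · rintro ⟨hk, hle⟩; exact ⟨hk, by omega⟩
    rw [hpd, mul_assoc]
    congr 1
    congr 1
    exact Finset.sum_congr rfl fun S _ => by rw [hmass S]

/-! ### 3. Identification of the relay count with the canonical model -/

/-- **Identification.**  With chain `ch : Fin D → E` (injective, off the blobs), blobs `G` (pairwise disjoint) at levels `lv k ≤ D`, the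
probability that the reached blobs carry `≥ j+1` relays equals the canonical tail with chain gates `q (ch i)`, sizes `a` and blob gates
`∏_{G k} q`.  Induction on `D`, conditioning on the top chain gate (`Quant.prodBernoulli_real_gate_split`). [this work] -/
theorem real_heavy_eq_tail : ∀ (D : ℕ) (q : E → unitInterval) (ch : Fin D → E), Function.Injective ch →
    ∀ (G : κ → Finset E), (∀ k k', k ≠ k' → Disjoint (G k) (G k')) → (∀ k (i : Fin D), ch i ∉ G k) →
    ∀ (lv : κ → ℕ), (∀ k, lv k ≤ D) → ∀ (a : κ → ℕ) (j : ℕ),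
    (prodBernoulli q).real {ω : Set E | j + 1 ≤ ∑ k ∈ Finset.univ.filter
        (fun k => (∀ i : Fin D, (i : ℕ) < lv k → ch i ∈ ω) ∧ ((G k : Finset E) : Set E) ⊆ ω), a k} =
      TAIL[D, (fun i => if h : i < D then ((q (ch ⟨i, h⟩) : unitInterval) : ℝ) else 1), lv, a,
        (fun k => ∏ e ∈ G k, (q e : ℝ)), j] := by
  intro D
  induction D with
  | zero =>
    intro q ch hch G hGdisj hGch lv hlv a j
    have hlv0 : ∀ k, lv k = 0 := fun k => Nat.le_zero.1 (hlv k)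
    have hev : {ω : Set E | j + 1 ≤ ∑ k ∈ Finset.univ.filter
        (fun k => (∀ i : Fin 0, (i : ℕ) < lv k → ch i ∈ ω) ∧ ((G k : Finset E) : Set E) ⊆ ω), a k} =
        {ω : Set E | j + 1 ≤ ∑ k ∈ Finset.univ.filter (fun k => lv k ≤ 0 ∧ ((G k : Finset E) : Set E) ⊆ ω), a k} := by
      ext ω
      simp only [Set.mem_setOf_eq]
      have : Finset.univ.filter (fun k => (∀ i : Fin 0, (i : ℕ) < lv k → ch i ∈ ω) ∧ ((G k : Finset E) : Set E) ⊆ ω) =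
          Finset.univ.filter (fun k => lv k ≤ 0 ∧ ((G k : Finset E) : Set E) ⊆ ω) := by
        ext k
        simp only [Finset.mem_filter, Finset.mem_univ, true_and, IsEmpty.forall_iff]
        exact ⟨fun h => ⟨(hlv0 k).le, h⟩, fun h => h.2⟩
      rw [this]
    rw [hev, real_blobCount_eq_sum q G hGdisj lv a 0 j, Finset.sum_range_one]
    have hpd : pd[0, (fun i => if h : i < 0 then ((q (ch ⟨i, h⟩) : unitInterval) : ℝ) else 1), 0] = 1 := by
      show (∏ i' ∈ Finset.range 0, (fun i => if h : i < 0 then ((q (ch ⟨i, h⟩) : unitInterval) : ℝ) else 1) i') *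
        (if 0 < 0 then 1 - (fun i => if h : i < 0 then ((q (ch ⟨i, h⟩) : unitInterval) : ℝ) else 1) 0 else (1 : ℝ)) = 1
      rw [Finset.prod_range_zero, if_neg (lt_irrefl 0), one_mul]
    rw [hpd, one_mul]
  | succ D ih =>
    intro q ch hch G hGdisj hGch lv hlv a j
    set e₀ : E := ch 0 with he₀
    set H : Set (Set E) := {ω : Set E | j + 1 ≤ ∑ k ∈ Finset.univ.filter
        (fun k => (∀ i : Fin (D + 1), (i : ℕ) < lv k → ch i ∈ ω) ∧ ((G k : Finset E) : Set E) ⊆ ω), a k} with hH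
    -- the shifted chain
    have hch'inj : Function.Injective (fun i : Fin D => ch i.succ) := fun i i' h => Fin.succ_injective _ (hch h)
    have hGch' : ∀ k (i : Fin D), (fun i : Fin D => ch i.succ) i ∉ G k := fun k i => hGch k i.succ
    have hlv' : ∀ k, (fun k => lv k - 1) k ≤ D := fun k => by have := hlv k; simp only; omega
    have he₀G : ∀ k, e₀ ∉ G k := fun k => hGch k 0
    have he₀ch' : ∀ i : Fin D, ch i.succ ≠ e₀ := fun i h => Fin.succ_ne_zero i (hch h)
    -- determined by all coordinates (for the update lemmas)
    have hdet : DeterminedBy H (↑(Finset.univ : Finset E) : Set E) := by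
      rw [determinedBy_iff]; intro ω ω' h
      simp only [Finset.coe_univ, Set.inter_univ] at h; rw [h]
    -- top gate OPEN: the event becomes the heavy event of the shifted chain
    have hopen : {ω : Set E | insert e₀ ω ∈ H} = {ω : Set E | j + 1 ≤ ∑ k ∈ Finset.univ.filter
        (fun k => (∀ i : Fin D, (i : ℕ) < lv k - 1 → ch i.succ ∈ ω) ∧ ((G k : Finset E) : Set E) ⊆ ω), a k} := by
      ext ω
      simp only [hH, Set.mem_setOf_eq]
      have hPQ : ∀ k, ((∀ i : Fin (D + 1), (i : ℕ) < lv k → ch i ∈ insert e₀ ω) ∧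
            ((G k : Finset E) : Set E) ⊆ insert e₀ ω) ↔
          ((∀ i : Fin D, (i : ℕ) < lv k - 1 → ch i.succ ∈ ω) ∧ ((G k : Finset E) : Set E) ⊆ ω) := by
        intro k
        have hG : ((G k : Finset E) : Set E) ⊆ insert e₀ ω ↔ ((G k : Finset E) : Set E) ⊆ ω := by
          constructor
          · intro h e he
            rcases Set.mem_insert_iff.1 (h he) with h1 | h1
            · exact absurd (Finset.mem_coe.1 he) (h1 ▸ he₀G k)
            · exact h1
          · intro h e he; exact Set.mem_insert_of_mem _ (h he)
        have hC : (∀ i : Fin (D + 1), (i : ℕ) < lv k → ch i ∈ insert e₀ ω) ↔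
            (∀ i : Fin D, (i : ℕ) < lv k - 1 → ch i.succ ∈ ω) := by
          constructor
          · intro h i hi
            have hlt : ((i.succ : Fin (D + 1)) : ℕ) < lv k := by rw [Fin.val_succ]; omega
            rcases Set.mem_insert_iff.1 (h i.succ hlt) with h2 | h2
            · exact absurd h2 (he₀ch' i)
            · exact h2
          · intro h i hi
            rcases Fin.eq_zero_or_eq_succ i with h0 | ⟨i', rfl⟩
            · rw [h0]; exact Set.mem_insert _ _
            · refine Set.mem_insert_of_mem _ (h i' ?_)
              have : ((i'.succ : Fin (D + 1)) : ℕ) = (i' : ℕ) + 1 := Fin.val_succ i'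
              omega
        exact hC.and hG
      apply Iff.of_eq
      congr 1
      refine Finset.sum_congr ?_ fun _ _ => rfl
      ext k
      simp only [Finset.mem_filter, Finset.mem_univ, true_and]
      exact hPQ k
    -- top gate CLOSED: only the root-level blobs count
    have hclosed : {ω : Set E | ω \ {e₀} ∈ H} =
        {ω : Set E | j + 1 ≤ ∑ k ∈ Finset.univ.filter (fun k => lv k ≤ 0 ∧ ((G k : Finset E) : Set E) ⊆ ω), a k} := by
      ext ω
      simp only [hH, Set.mem_setOf_eq]
      have hPQ : ∀ k, ((∀ i : Fin (D + 1), (i : ℕ) < lv k → ch i ∈ ω \ {e₀}) ∧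
            ((G k : Finset E) : Set E) ⊆ ω \ {e₀}) ↔ (lv k ≤ 0 ∧ ((G k : Finset E) : Set E) ⊆ ω) := by
        intro k
        have hG : ((G k : Finset E) : Set E) ⊆ ω \ {e₀} ↔ ((G k : Finset E) : Set E) ⊆ ω := by
          constructor
          · intro h e he; exact (h he).1
          · intro h e he
            exact ⟨h he, fun h1 => he₀G k ((Set.mem_singleton_iff.1 h1) ▸ Finset.mem_coe.1 he)⟩
        have hC : (∀ i : Fin (D + 1), (i : ℕ) < lv k → ch i ∈ ω \ {e₀}) ↔ lv k ≤ 0 := by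
          constructor
          · intro h
            by_contra hne
            have hlt : ((0 : Fin (D + 1)) : ℕ) < lv k := by simp only [Fin.val_zero]; omega
            exact (h 0 hlt).2 (Set.mem_singleton _)
          · intro h i hi; omega
        exact hC.and hG
      apply Iff.of_eq
      congr 1
      refine Finset.sum_congr ?_ fun _ _ => rfl
      ext k
      simp only [Finset.mem_filter, Finset.mem_univ, true_and]
      exact hPQ k
    -- the three probabilities
    have hA : (prodBernoulli q).real {ω : Set E | insert e₀ ω ∈ H} =
        TAIL[D, (fun i => if h : i < D then ((q (ch (Fin.succ ⟨i, h⟩)) : unitInterval) : ℝ) else 1),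
          (fun k => lv k - 1), a, (fun k => ∏ e ∈ G k, (q e : ℝ)), j] := by
      rw [hopen]
      exact ih q (fun i : Fin D => ch i.succ) hch'inj G hGdisj hGch' (fun k => lv k - 1) hlv' a j
    have hB : (prodBernoulli q).real {ω : Set E | ω \ {e₀} ∈ H} =
        ∑ S : Finset κ, wt[(fun k => ∏ e ∈ G k, (q e : ℝ)), S] * (if j + 1 ≤ mass[lv, a, 0, S] then (1 : ℝ) else 0) := by
      rw [hclosed]
      exact real_blobCount_eq_sum q G hGdisj lv a 0 j
    have hsplit := prodBernoulli_real_gate_split q e₀ H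
    rw [prodBernoulli_real_update_one_eq hdet q (Finset.mem_univ e₀),
      prodBernoulli_real_update_zero_eq hdet q (Finset.mem_univ e₀), hA, hB] at hsplit
    rw [hsplit]
    -- assemble with `tail_succ`
    have hT := tail_succ D (fun i => if h : i < D + 1 then ((q (ch ⟨i, h⟩) : unitInterval) : ℝ) else 1) lv a
      (fun k => ∏ e ∈ G k, (q e : ℝ)) j
    have hchain : (fun i => if h : i + 1 < D + 1 then ((q (ch ⟨i + 1, h⟩) : unitInterval) : ℝ) else 1) =
        (fun i => if h : i < D then ((q (ch (Fin.succ ⟨i, h⟩)) : unitInterval) : ℝ) else 1) := by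
      funext i
      by_cases h : i < D
      · have h' : i + 1 < D + 1 := Nat.succ_lt_succ h
        rw [dif_pos h', dif_pos h]
        rfl
      · have h' : ¬ (i + 1 < D + 1) := fun h'' => h (Nat.lt_of_succ_lt_succ h'')
        rw [dif_neg h', dif_neg h]
    have hz : (⟨0, Nat.succ_pos D⟩ : Fin (D + 1)) = 0 := by ext; simp
    have hq0 : (if h : 0 < D + 1 then ((q (ch ⟨0, h⟩) : unitInterval) : ℝ) else 1) = ((q e₀ : unitInterval) : ℝ) := by
      rw [dif_pos (Nat.succ_pos D), hz]
    rw [hT, hchain, hq0]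
    ring

/-! ### 4. FAR for block-combs in the strong regime, gate coordinates -/

/-- **FAR at every layer for block-combs in the strong regime (gate coordinates).**  Independent gates `q` on `E`; a chain `ch : Fin D → E`
(injective); blobs with pairwise disjoint private gate sets `G k` off the chain, levels `lv k ≤ D`; blob `k` is reached when the chain prefix
of length `lv k` and all of `G k` are open, contributing `|G k|` relays.  If `2j < (Σ_k |G k|)·∏_{e∈G k} q e` for every nonempty blob and
`1 − (∏_{i<lv k} q (ch i))·∏_{G k} q ≤ t` for every nonempty blob, then `P(#reached relays ≤ j) ≤ t`.  Contains every ALL-TIED block-comb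
(there the hypothesis is `EN > 2j`).  Proof: `real_heavy_eq_tail` + `Quant.BlockComb.tail_ge_of_le_marg_strong`. [this work] -/
theorem farTree_blockComb_strong (q : E → unitInterval) (D : ℕ) (ch : Fin D → E) (hch : Function.Injective ch)
    (G : κ → Finset E) (hGdisj : ∀ k k', k ≠ k' → Disjoint (G k) (G k')) (hGch : ∀ k (i : Fin D), ch i ∉ G k)
    (lv : κ → ℕ) (hlv : ∀ k, lv k ≤ D) (j : ℕ) (t : ℝ)
    (hstrong : ∀ k, (G k).Nonempty → (2 * j : ℝ) < (∑ k', ((G k').card : ℝ)) * ∏ e ∈ G k, (q e : ℝ))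
    (hne : ∃ k, (G k).Nonempty)
    (ht : ∀ k, (G k).Nonempty →
      1 - (∏ i ∈ Finset.range (lv k), (if h : i < D then ((q (ch ⟨i, h⟩) : unitInterval) : ℝ) else 1)) *
        ∏ e ∈ G k, (q e : ℝ) ≤ t) :
    (prodBernoulli q).real {ω : Set E | ∑ k ∈ Finset.univ.filter
        (fun k => (∀ i : Fin D, (i : ℕ) < lv k → ch i ∈ ω) ∧ ((G k : Finset E) : Set E) ⊆ ω), (G k).card ≤ j} ≤ t := by
  set H : Set (Set E) := {ω : Set E | j + 1 ≤ ∑ k ∈ Finset.univ.filter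
        (fun k => (∀ i : Fin D, (i : ℕ) < lv k → ch i ∈ ω) ∧ ((G k : Finset E) : Set E) ⊆ ω), (G k).card} with hH
  have hcompl : {ω : Set E | ∑ k ∈ Finset.univ.filter
        (fun k => (∀ i : Fin D, (i : ℕ) < lv k → ch i ∈ ω) ∧ ((G k : Finset E) : Set E) ⊆ ω), (G k).card ≤ j} = Hᶜ := by
    ext ω; simp only [hH, Set.mem_setOf_eq, Set.mem_compl_iff, not_le]; omega
  have hheavy : (prodBernoulli q).real H =
      TAIL[D, (fun i => if h : i < D then ((q (ch ⟨i, h⟩) : unitInterval) : ℝ) else 1), lv, (fun k => (G k).card),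
        (fun k => ∏ e ∈ G k, (q e : ℝ)), j] :=
    real_heavy_eq_tail D q ch hch G hGdisj hGch lv hlv (fun k => (G k).card) j
  rw [hcompl, probReal_compl_eq_one_sub MeasurableSet.of_discrete, hheavy]
  -- the canonical theorem
  set qc : ℕ → ℝ := fun i => if h : i < D then ((q (ch ⟨i, h⟩) : unitInterval) : ℝ) else 1 with hqc
  set g : κ → ℝ := fun k => ∏ e ∈ G k, (q e : ℝ) with hg
  have hqc01 : ∀ i, 0 ≤ qc i ∧ qc i ≤ 1 := by
    intro i
    by_cases h : i < D
    · simp only [hqc, dif_pos h]; exact ⟨(q _).2.1, (q _).2.2⟩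
    · simp only [hqc, dif_neg h]; norm_num
  have hg01 : ∀ k, 0 ≤ g k ∧ g k ≤ 1 := fun k =>
    ⟨Finset.prod_nonneg fun e _ => (q e).2.1, Finset.prod_le_one (fun e _ => (q e).2.1) fun e _ => (q e).2.2⟩
  have hlive : ∀ k, 0 < (G k).card ↔ (G k).Nonempty := fun k => Finset.card_pos
  have hlv' : ∀ k, 0 < (G k).card → lv k ≤ D := fun k _ => hlv k
  have hstrong' : ∀ k, 0 < (G k).card → (2 * j : ℝ) < (∑ k', ((G k').card : ℝ)) * g k :=
    fun k hk => hstrong k ((hlive k).1 hk)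
  have hne' : ∃ k, 0 < (G k).card := by obtain ⟨k, hk⟩ := hne; exact ⟨k, (hlive k).2 hk⟩
  have hx : ∀ k, 0 < (G k).card → 1 - t ≤ (∏ i ∈ Finset.range (lv k), qc i) * g k :=
    fun k hk => by have := ht k ((hlive k).1 hk); linarith
  have key := BlockComb.tail_ge_of_le_marg_strong D qc hqc01 lv (fun k => (G k).card) g hg01 j hlv' hstrong' hne' (1 - t) hx
  linarith


/-- **General class sizes.**  As `farTree_blockComb_strong`, but a reached blob `k` contributes an arbitrary number `a k` of relays (so `G k`
may contain non-relay and sure gates — the hair above a glued class): `2j < (Σ a)·∏_{G k} q` and `1 − marginal k ≤ t` for every `k` with `a k > 0`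
give `P(Σ_{k reached} a k ≤ j) ≤ t`; for `Quant.FarTreeRow` block-combs, `a k = #(relays of class k)`, `G k = P b ∖ chain`. [this work] -/
theorem farTree_blockComb_strong_sizes (q : E → unitInterval) (D : ℕ) (ch : Fin D → E) (hch : Function.Injective ch)
    (G : κ → Finset E) (hGdisj : ∀ k k', k ≠ k' → Disjoint (G k) (G k')) (hGch : ∀ k (i : Fin D), ch i ∉ G k)
    (lv : κ → ℕ) (hlv : ∀ k, lv k ≤ D) (a : κ → ℕ) (j : ℕ) (t : ℝ)
    (hstrong : ∀ k, 0 < a k → (2 * j : ℝ) < (∑ k', (a k' : ℝ)) * ∏ e ∈ G k, (q e : ℝ))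
    (hne : ∃ k, 0 < a k)
    (ht : ∀ k, 0 < a k →
      1 - (∏ i ∈ Finset.range (lv k), (if h : i < D then ((q (ch ⟨i, h⟩) : unitInterval) : ℝ) else 1)) *
        ∏ e ∈ G k, (q e : ℝ) ≤ t) :
    (prodBernoulli q).real {ω : Set E | ∑ k ∈ Finset.univ.filter
        (fun k => (∀ i : Fin D, (i : ℕ) < lv k → ch i ∈ ω) ∧ ((G k : Finset E) : Set E) ⊆ ω), a k ≤ j} ≤ t := by
  set H : Set (Set E) := {ω : Set E | j + 1 ≤ ∑ k ∈ Finset.univ.filter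
        (fun k => (∀ i : Fin D, (i : ℕ) < lv k → ch i ∈ ω) ∧ ((G k : Finset E) : Set E) ⊆ ω), a k} with hH
  have hcompl : {ω : Set E | ∑ k ∈ Finset.univ.filter
        (fun k => (∀ i : Fin D, (i : ℕ) < lv k → ch i ∈ ω) ∧ ((G k : Finset E) : Set E) ⊆ ω), a k ≤ j} = Hᶜ := by
    ext ω; simp only [hH, Set.mem_setOf_eq, Set.mem_compl_iff, not_le]; omega
  have hheavy : (prodBernoulli q).real H =
      TAIL[D, (fun i => if h : i < D then ((q (ch ⟨i, h⟩) : unitInterval) : ℝ) else 1), lv, a,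
        (fun k => ∏ e ∈ G k, (q e : ℝ)), j] :=
    real_heavy_eq_tail D q ch hch G hGdisj hGch lv hlv a j
  rw [hcompl, probReal_compl_eq_one_sub MeasurableSet.of_discrete, hheavy]
  set qc : ℕ → ℝ := fun i => if h : i < D then ((q (ch ⟨i, h⟩) : unitInterval) : ℝ) else 1 with hqc
  set g : κ → ℝ := fun k => ∏ e ∈ G k, (q e : ℝ) with hg
  have hqc01 : ∀ i, 0 ≤ qc i ∧ qc i ≤ 1 := fun i => by
    by_cases h : i < D
    · simp only [hqc, dif_pos h]; exact ⟨(q _).2.1, (q _).2.2⟩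
    · simp only [hqc, dif_neg h]; norm_num
  have hg01 : ∀ k, 0 ≤ g k ∧ g k ≤ 1 := fun k =>
    ⟨Finset.prod_nonneg fun e _ => (q e).2.1, Finset.prod_le_one (fun e _ => (q e).2.1) fun e _ => (q e).2.2⟩
  have hx : ∀ k, 0 < a k → 1 - t ≤ (∏ i ∈ Finset.range (lv k), qc i) * g k := fun k hk => by have := ht k hk; linarith
  have key := BlockComb.tail_ge_of_le_marg_strong D qc hqc01 lv a g hg01 j (fun k _ => hlv k) hstrong hne (1 - t) hx
  linarith

end BlockCombGate

end Quant

end Summit.CriticalPhenomena.PercolationContinuityZ3.Theorems
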